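import Summits.QuantumFields.YangMills.Theorems.BalabanUVNodesN12TowerBoxInsideZ
import Literature.MathematicalPhysics.QuantumFieldTheory.Balaban1983to89.Node00.MultiScaleFibreChartB
import HarnessLib

/-!
# DAG node N12 [B15] — THE TOWER BOX OF A POSITIVE-LEVEL CONSTRAINED BOND OF `𝐁_k(Z)` LIES INSIDE `Z` (all four corners of each of its plaquettes), HENCE THE PULL-BACK DATUM'S TOWER — **BOND-DATUM EDITION** (`…N12TowerBoxInsideZB`, USED DECLARATIONS ONLY)

The print-datum ([Balaban1984PropagatorsII] (2.3)) (γ) twin of `Summits/…/Theorems/BalabanUVNodesN12TowerBoxInsideZ.lean`: the declarations of the parent whose STATEMENT reads the determining datum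
(`guardOn_towerRegion_Bj_qsstarGIter0_of_plaqSmallOn_Z`) and which N12's junction of record v14ᴸ uses (dag-n12-c g35 probe-2 census `UsedConstsN12RoadTyped2`, THEOREMS block), re-typed over a
BOND-LEVEL datum `𝔅 : BDetSet` (F0a `B15DeterminingSetsB`) and dag-n12-c's bond-datum chart `Node00.msChartB` (✓p774329; `msChart 𝐁 = msChartB (bondsDet 𝐁)` by `rfl`).  GENERATOR twin
(this seat's `work/g32/gen_thm.py`, block-extracted from the parent's tree bytes): namespace `…N12TowerBoxInsideZB`, SAME short names, `DetSet ↦ BDetSet`, `AgreeOn 𝐁 ↦ AgreeOnB 𝔅`,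
`IsMinimizer ↦ IsMinimizerB`, `bondsOf (𝐁 j) ↦ 𝔅 j`, `msChart ∕ constrCard ∕ constrEnum ∕ ConstrSet ↦ …B`, NODE 00 chart lemmas `…msChart… ↦ …msChartB…`; proofs VERBATIM; the parent's
datum-free declarations REUSED BY NAME (`open`), never copied (private plumbing excepted, №366 R2).  The parent's (b) statements are the instances `𝔅 := bondsDet 𝐁`.

Cell `pub-ymgap` (HUMAN RULINGS D-0062 ∕ D-0149), seat `pub-ymgap-dag-n12-d` g32 (R134 N12 [B15] s2; the (ii) Theorems-side re-key of N12's road at print's [II] (2.3) datum — director-ym №338 ∕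
№343 (E1)(iii-b), FLAG №16 ∕ ruling (α); dag-n12-c DESIGN memo a793b2ebc0b803bf (ii); `N12-ROAD-TWIN-ORDER-2026-08-30.md`).  Count-neutral helper of K1⁹ `stmt-QuantumFields-27364`,
`--kind proof --supports … --as helper`.  THEOREMS ONLY (0 `def`, 0 `instance`, 0 `sorry`).

HONEST FRAMING (director-ym №338 (5)).  PURELY ADDITIVE: the parent stays landed and true on its own text; nothing in it is edited; no displayed premise of any consumer is deleted or
weakened; every hypothesis of the parent stays a hypothesis.  Nothing of Bałaban's analysis asserted; N12 NOT discharged; K0⁷ ∕ K1⁹ NOT closed; counts unmoved (typed 28∕28 · discharged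
8∕27, A 8∕28; K 1∕4); one finite 𝕋⁴ programme at fixed ε — R4 closes the conditional rung `BalabanLadder.UV` only; NOT the Yang–Mills mass gap (Clay); nothing continuum ∕ ℝ⁴ ∕ OS.

PARENT's DOCSTRING (the mathematics and the citations; read the site-level `𝐁` as the bond datum `𝔅`):
# DAG node N12 [B15] — THE TOWER BOX OF A POSITIVE-LEVEL CONSTRAINED BOND OF `𝐁_k(Z)` LIES INSIDE `Z` (all four corners of each of its plaquettes), HENCE THE PULL-BACK DATUM'S TOWER
# GUARDS FROM SCALE-`k` REGULARITY OF `Ṽ_k` ON `Z` — the geometry row `hbox` of `N12TowerGuardsOfClass.guardOn_towerRegion_qsstarGIter0_of_plaqSmallOn` DISCHARGED at the record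

[Balaban1988Convergent] = «[III]», (2.2) p. 255, (2.13) pp. 256–257 («dist(Ω_n, Ωᶜ_{n−1}) ≧ LⁿξM₁»); [Balaban1989LargeFieldI] = «[IV]», (1.74) p. 192, p. 193 ll. 14–20;
[BalabanImbrieJaffe1985] (4.5.3) p. 312; [Balaban1987RG1] (0.1) p. 251, (0.4) p. 253.

Cell `pub-ymgap`, HUMAN RULINGS D-0062 ∕ D-0149, lane owner `pub-ymgap-dag-n12-c` (g24).  Key K1⁹ `stmt-QuantumFields-27364`, `--kind proof --supports … --as helper`; count-neutral.
NEW leaf; CONSUMED BY NAME, nothing modified: dag-n12-w6's `N12WindowNearRegionGeometry` (`exists_word_endpoints`, `walkEnd_eq_cover_and_within`) ∕ `N12GaugeLetterLocOfClass.exists_cover_of_mem_boxPlaqs`,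
r12's `B14.Eq213DetSet.dist_maxDomT` ∕ `maxDomT_subset`, n28's `B15Claim189CubePin.cover_add_single`, this lane's `N12TowerGuardsOfClass` (step (r2)).

WHY.  Step (r2)'s datum supplier `guardOn_towerRegion_qsstarGIter0_of_plaqSmallOn` displays ONE geometry row `hbox`: the fine plaquettes of the tower box of the constrained bond have all four
corners in a union of `k`-blocks `Y` on whose scale-`k` plaquettes the datum `V` is small.  At the record `Y = Z` ((Gᵃ) `hZblk : IsBlockUnion k Z`; `Ṽ_k = ext V_k` is regular on
`plaqsInside (pts k Z)` by `B15ShellGauge193Local.dist1_plaqHol_extend_shellGauge_le`), and the row HOLDS: a level-`j` constrained bond (`1 ≤ j ≤ k`) has an end in `Γ_j ⊆ Ω_j(Z)^{(j)}`; its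
tower box (half-width `3Lʲ − 3` (+2) about `ι_j c₋`, itself within `Lʲ` of that end) lies within `4Lʲ` of a point of `Ω_j(Z)`, and print's collar `dist(Ω_j, Ω_{j−1}ᶜ) ≥ LʲM₁` (`dist_maxDomT`,
`4L ≤ M₁`) puts every corner of every box plaquette in `Ω_{j−1}(Z) ⊆ Z`.

CONTENTS (namespace `Summit.QuantumFields.YangMills.BalabanUVNodes.N12TowerBoxInsideZ`; theorems only — no `def`, no `instance`, no `sorry`).
* §1 `within_one_self` · `within_one_add_single` · `within_one_add_single_add_single` (cover bookkeeping of the four corners).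
* §2 ★★ `towerBoxPlaqs_subset_maxDomT_pred` (every corner in `Ω_{j−1}(Z)`) · ★★★ `towerBoxPlaqs_subset_plaqsInside` (the row `hbox` at `Y = Z`).
* §3 ★★★ `guardOn_towerRegion_qsstarGIter0_of_plaqSmallOn_Z` (the pull-back datum `Q_k^{s*}V` is (0.4)-guarded along the tower of every positive-level constrained bond of `𝐁_k(Z)`, from
  `IsBlockUnion k Z`, `PlaqSmallOn (plaqsInside (pts k Z)) δ V`, the radius letter and the budget `(d−1)(6Lʲ−4)·δ ≤ ρ″`) · ★★★ `guardOn_towerRegion_Bj_qsstarGIter0_of_plaqSmallOn_Z`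
  (enumerated over `constrEnum (𝐁_k(Z)) k`, level `0` vacuous; budget in the `j`-free form `6(d−1)Lᵏ·δ ≤ ρ″`) — the replacement text for the w1 lineage's `hsbQ`, INHABITED at the record.

HONEST FRAMING ∕ LOCATED.  Lattice∕cover bookkeeping over landed modules; the radius `ρ″` remains an ∃-constant per height (letter `hsbU`), the budget a volume-free smallness floor; nothing of
Bałaban's asserted; count-neutral helper; N12 NOT discharged; K1⁹ NOT closed; counts unmoved; one finite 𝕋⁴ programme at fixed ε — R4 closes the conditional finite-𝕋⁴ rung
`BalabanLadder.UV` only; NOT continuum ∕ OS ∕ mass gap ∕ Clay.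
-/

noncomputable section

open scoped BigOperators Matrix.Norms.L2Operator Topology

namespace Summit.QuantumFields.YangMills.BalabanUVNodes.N12TowerBoxInsideZB

open Literature.MathematicalPhysics.QuantumFieldTheory.Balaban1983to89.B15DeterminingSetsB

open Literature.MathematicalPhysics.QuantumFieldTheory.Balaban1983to89
open T4Continuum (T4Family walkEnd Letter netDisp wordRev walkEnd_walkEnd_wordRev)
open BlockAveraging (Small blockAvg)
open B15DeterminingSets
open B14.Eq213MaximalDomains (side)
open B14.Eq213DetSet (Bj Bj_mid Bj_top maxDomT maxDomT_subset dist_maxDomT)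
open B14.Eq22Determines (blockIter IsBlockUnion)
open B14DomainGeom (Within Pt)
open B15Eq112TorusCover (cover lift cover_lift)
open B15Claim189CubePin (cover_add_single)
open B10Eq42TorusConstraint (bondsIn)
open B15Prop1Carrier (plaqsInside)
open ExpMeanLog (expMeanLogSU)
open T4AxialGaugeSmallField (boxPlaqs)
open T4ReflectionCone (three_le_L)
open Node00 (Stage7Numerics SU coeField SmallBelow avOfRecord constrCardB constrEnumB)
open Literature.MathematicalPhysics.QuantumFieldTheory.BalabanImbrieJaffe1984to88.BIJ85Eq453GaugeField (qsstarGIter0)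
open Summit.QuantumFields.YangMills.BalabanUVNodes.N12GaugeLetterLocOfClass (exists_cover_of_mem_boxPlaqs)
open Summit.QuantumFields.YangMills.BalabanUVNodes.N12WindowNearRegionGeometry (exists_word_endpoints walkEnd_eq_cover_and_within)
open Summit.QuantumFields.YangMills.BalabanUVNodes.N12TowerGuardsOfClass (guardOn_towerRegion_qsstarGIter0_of_plaqSmallOn)
open B15AveragingHolomorphicTowerRegion (guardOn_towerRegion_zero)
open Summit.QuantumFields.YangMills.BalabanUVNodes.N12TowerBoxInsideZ (guardOn_towerRegion_qsstarGIter0_of_plaqSmallOn_Z)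

section
variable {F : T4Family} {N : ℕ} [NeZero N]

/-- ★★★ **THE DATUM's TOWER GUARDS AT EVERY CONSTRAINED BOND OF `𝐁_k(Z)`, ENUMERATED** — the replacement text for the w1 lineage's global letter `hsbQ : SmallBelow k (Q_k^{s*}Ṽ_k)` (the `hgQ` row
of `B15Prop1MinimiserFamilyFromThm1AtBaseCentralTower.hMin_atRecord_of_node00Letters_thm1AtBase_central_of_guardOn` at `𝔅 = 𝐁_k(Z)`), INHABITED from scale-`k` regularity of `V` on `Z`
(level `0`: vacuous; positive levels: above, with the `j`-free budget `6(d−1)Lᵏ·δ ≤ ρ″`). [cite: Balaban1989LargeFieldI, (1.74) p.192, p.193 L14–20; Balaban1988Convergent, (2.2) p.255, (2.10)–(2.13) pp.256–257; Balaban1987RG1, (0.4) p.253] -/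
theorem guardOn_towerRegion_lamBondsSeq_qsstarGIter0_of_plaqSmallOn_Z (ν : Stage7Numerics) (Kt : ℕ) (hd : 2 ≤ (F.P Kt).d) {k : ℕ} (Z : Set (Site (F.P Kt) 0))
    (hkK : k + 1 ≤ (F.P Kt).m + (F.P Kt).K) (hM4 : 4 * (F.P Kt).L ≤ ν.M₁) (hdiv : side (F.P Kt).L ν.M₁ k ∣ (F.P Kt).sitesPerDir 0)
    (hZblk : IsBlockUnion k Z) {δ : ℝ} (hδ : 0 < δ) {V : GaugeField (F.P Kt) k (SU N)} (hV : PlaqSmallOn (plaqsInside (pts k Z)) δ V)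
    {ρ'' : ℝ} (hsbU : ∀ W : GaugeField (F.P Kt) 0 (SU N), ‖coeField W - 1‖ ≤ ρ'' → SmallBelow (avOfRecord F N Kt) k W)
    (hbudget : 6 * ((((F.P Kt).d - 1 : ℕ)) : ℝ) * (F.P Kt).L ^ k * δ ≤ ρ'') :
    ∀ i : Fin (constrCardB (lamBondsSeq (maxDomT ν.M₁ Z) k) k), ∀ j', j' < (((constrEnumB (lamBondsSeq (maxDomT ν.M₁ Z) k) k).symm i).1 : ℕ) →
      ∀ c' : PBond (F.P Kt) (j' + 1),
        c' ∈ bondsIn (j' + 1) (blockIter (((constrEnumB (lamBondsSeq (maxDomT ν.M₁ Z) k) k).symm i).1 : ℕ)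
          ⁻¹' ({((constrEnumB (lamBondsSeq (maxDomT ν.M₁ Z) k) k).symm i).2.1.src, ((constrEnumB (lamBondsSeq (maxDomT ν.M₁ Z) k) k).symm i).2.1.tgt} :
            Set (Site (F.P Kt) ((constrEnumB (lamBondsSeq (maxDomT ν.M₁ Z) k) k).symm i).1))) →
          Small expMeanLogSU (Averaging.iter (avOfRecord F N Kt) j' (qsstarGIter0 k V)) c' := by
  intro i
  have key : ∀ j, j ≤ k → ∀ c : PBond (F.P Kt) j, c ∈ bondsOf (Bj ν.M₁ Z k j) →
      ∀ j', j' < j → ∀ c' : PBond (F.P Kt) (j' + 1), c' ∈ bondsIn (j' + 1) (blockIter j ⁻¹' ({c.src, c.tgt} : Set (Site (F.P Kt) j))) →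
        Small expMeanLogSU (Averaging.iter (avOfRecord F N Kt) j' (qsstarGIter0 k V)) c' := by
    intro j hj c hc
    rcases Nat.eq_zero_or_pos j with rfl | hj1
    · exact guardOn_towerRegion_zero c (qsstarGIter0 k V)
    · refine guardOn_towerRegion_qsstarGIter0_of_plaqSmallOn_Z ν Kt hd Z hkK hM4 hdiv hZblk hδ hV hsbU hj1 hj (le_trans ?_ hbudget) hc
      -- `(d−1)(6Lʲ−4)·δ ≤ 6(d−1)Lᵏ·δ`
      have hpow : (((6 * (F.P Kt).L ^ j - 4 : ℕ) : ℕ) : ℝ) ≤ 6 * ((F.P Kt).L : ℝ) ^ k := by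
        have h1 : (6 * (F.P Kt).L ^ j - 4 : ℕ) ≤ 6 * (F.P Kt).L ^ k :=
          le_trans (Nat.sub_le _ _) (Nat.mul_le_mul_left _ (Nat.pow_le_pow_right (F.P Kt).L_pos hj))
        exact_mod_cast h1
      have hd0 : (0 : ℝ) ≤ (((F.P Kt).d - 1 : ℕ) : ℝ) := by positivity
      calc ((((F.P Kt).d - 1 : ℕ)) : ℝ) * ((6 * (F.P Kt).L ^ j - 4 : ℕ) : ℕ) * δ
          ≤ ((((F.P Kt).d - 1 : ℕ)) : ℝ) * (6 * ((F.P Kt).L : ℝ) ^ k) * δ := by gcongr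
        _ = 6 * ((((F.P Kt).d - 1 : ℕ)) : ℝ) * (F.P Kt).L ^ k * δ := by ring
  exact key _ (Nat.le_of_lt_succ ((constrEnumB (lamBondsSeq (maxDomT ν.M₁ Z) k) k).symm i).1.2) _ (lamBondsSeq_subset_bondsOf_genSet _ _ _ ((constrEnumB (lamBondsSeq (maxDomT ν.M₁ Z) k) k).symm i).2.2)

end

end Summit.QuantumFields.YangMills.BalabanUVNodes.N12TowerBoxInsideZB

end
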